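import Summits.QuantumFields.Balaban3D.Proofs.Representation33

/-!
# Non-vacuity witness for `…Balaban3D.Representation33.ChartExpansion` (prover seat p6, lane `pub-balaban3d`)

The hypothesis structure `ChartExpansion T k ι E κc` of the sibling `…Balaban3D.Representation33` (the printed inputs
(25), (27)–(29), (32) of [Balaban1985UV3] pp. 262–264 and the lane's GAP binder G3D-01
`Balaban1985CMP102.Binders.ChartAnalyticityAsCited`) is INHABITED over LQB's trivial run `B10Assembly.trivRun K`
(every piece 0, b₀ = 0) with a genuinely NON-LINEAR chart function `Ψ = z ↦ z²` on `E = ℂ` (holomorphic, bounded by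
¼ on the closed ball of radius ½, first derivative 0 at 0 — the shape of (32)), and the leaf theorem
`repr33_60_of_chart` FIRES on it: `Repr33_60 (trivPieces K k) (rawConst7 …)`.  A consistency check of the TYPING in
the standard of LQB `B10Assembly.trivLeafSystem` (§5 there), NOT a statement about Yang–Mills; nothing of the paper is
asserted.  Source of the typed displays: T. Bałaban, Commun. Math. Phys. **102** (1985) 255–275 [Balaban1985UV3].
-/

noncomputable section

open scoped Topology
open Metric Set Finset
open Literature.MathematicalPhysics.QuantumFieldTheory.Balaban1983to89
open Literature.MathematicalPhysics.QuantumFieldTheory.Balaban1983to89.B10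
open Literature.MathematicalPhysics.QuantumFieldTheory.Balaban1983to89.B10SectAGathering
open Literature.MathematicalPhysics.QuantumFieldTheory.Balaban1983to89.B10Assembly
open Literature.MathematicalPhysics.QuantumFieldTheory.Balaban1985CMP102.Binders (ChartAnalyticityAsCited)
open Summit.QuantumFields.Balaban3D.Proofs.Representation33

namespace Summit.QuantumFields.Balaban3D.Proofs.Representation33Witness

/-- Model constants: radius ρ = 1, (28)-constant cB = 1, r₀ = 1, CM = ¼, Cfar = 0. [folklore] -/
def trivChartConsts : ChartConsts where
  ρ := 1
  cB := 1
  r₀ := 1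
  CM := 1 / 4
  Cfar := 0
  ρ_pos := one_pos
  cB_nonneg := zero_le_one
  r₀_nonneg := zero_le_one
  CM_nonneg := by norm_num
  Cfar_nonneg := le_rfl

/-- `z ↦ z²` on `ℂ` satisfies the G3D-01 binder with radius 1 and bound ¼ on the closed ball of radius ½. [folklore] -/
theorem sq_chart : ChartAnalyticityAsCited (fun z : ℂ => z ^ 2) 1 (1 / 4) := by
  refine ⟨one_pos, (differentiable_pow 2).differentiableOn, fun z hz => ?_⟩
  rw [mem_closedBall, dist_zero_right] at hz
  rw [norm_pow]
  nlinarith [norm_nonneg z]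

/-- The shape of (32) for the model: the derivative of `z ↦ z²` at `0` vanishes. [folklore] -/
theorem fderiv_sq_zero : fderiv ℂ (fun z : ℂ => z ^ 2) 0 = 0 := by
  have h : HasDerivAt (fun z : ℂ => z ^ 2) 0 0 := by
    simpa using hasDerivAt_pow 2 (0 : ℂ)
  rw [h.hasFDerivAt.fderiv]
  ext
  simp

/-- `|T₁^{(k)}| ≥ 1` along the trivial run for `k ≤ K` (spacing 2^{−K}: (2^k·2^{−K})^{−3} ≥ 1). [folklore] -/
theorem one_le_sites_trivRun {K k : ℕ} (hk : k ≤ K) : (1 : ℝ) ≤ (trivRun K).sites k := by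
  show (1 : ℝ) ≤ ((2 : ℝ) ^ k * ((2 : ℝ) ^ K)⁻¹)⁻¹ ^ 3 * 1
  rw [mul_one]
  have ht : 0 < (2 : ℝ) ^ k * ((2 : ℝ) ^ K)⁻¹ := by positivity
  exact one_le_pow₀ ((one_le_inv₀ ht).2 (two_pow_mul_inv_le_one hk))

/-- `g_k ≤ 1` along the trivial run for `k ≤ K`. [folklore] -/
theorem g_le_one_trivRun {K k : ℕ} (hk : k ≤ K) : (trivRun K).g k ≤ 1 := by
  show 1 * Real.sqrt ((2 : ℝ) ^ k * ((2 : ℝ) ^ K)⁻¹) ≤ 1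
  rw [one_mul]
  calc Real.sqrt ((2 : ℝ) ^ k * ((2 : ℝ) ^ K)⁻¹) ≤ Real.sqrt 1 := Real.sqrt_le_sqrt (two_pow_mul_inv_le_one hk)
    _ = 1 := Real.sqrt_one

/-- **`ChartExpansion` is inhabited**: one localization, chart function `z ↦ z²`, chart configuration `B ≡ 0` (forced:
the trivial run has b₀ = 0, so the (28) window is 0), one block. [folklore] -/
def trivChart (K k : ℕ) (hk : k ≤ K) : ChartExpansion (trivRun K) k Unit ℂ trivChartConsts where
  loc := fun _ => {()}
  Ψ := fun _ z => z ^ 2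
  Bcfg := fun _ _ _ => 0
  M := fun _ => 1 / 4
  chart := fun _ => sq_chart
  vol := fun _ => 1
  vol_nonneg := fun _ => zero_le_one
  vol_le := fun _ => one_le_sites_trivRun hk
  sumM_le := fun _ => by simp [trivChartConsts]
  bound28 := fun _ _ _ => by
    rw [norm_zero]
    simp [trivRun, trivChartConsts, pFun]
  small28 := by simp [trivRun, trivChartConsts, pFun]
  eq32 := fun _ => fderiv_sq_zero
  far := fun _ _ _ => 0
  far_le := fun _ _ _ => by simp [trivChartConsts]

/-- **The leaf theorem fires on the witness**: `Repr33_60` for the trivial step pieces with the constant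
`rawConst7 Craw b₀ r₀ p₀ g κ₀` at `(Craw, b₀, r₀, p₀, g, κ₀) = (trivChartConsts.Craw, 0, 1, 1, 1, ¼)`. [folklore] -/
theorem repr33_60_trivRun (K k : ℕ) (hk : k ≤ K) :
    Repr33_60 (trivPieces K k) (rawConst7 trivChartConsts.Craw (trivRun K).b₀ trivChartConsts.r₀ (trivRun K).p₀ 1 (1 / 4)) :=
  repr33_60_of_chart (trivPieces K k) (trivChart K k hk) 1 2 (((2 : ℝ) ^ K)⁻¹) (1 / 4) one_pos two_pos
    (by positivity) (by norm_num) (by show (0 : ℝ) < 1; norm_num) (by show (0 : ℝ) ≤ 0; rfl) rfl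
    (g_le_one_trivRun hk) rfl
    (fun h U => by simp [ChartExpansion.total, trivChart, trivPieces])
    (fun h => by simp [ChartExpansion.total0, trivChart, trivPieces])
    (fun h U => by simp [ChartExpansion.poly, trivChart, trivPieces, jet26_apply_zero])

end Summit.QuantumFields.Balaban3D.Proofs.Representation33Witness

end
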